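import Summits.CriticalPhenomena.PercolationContinuityZ3.Theorems.Transplant.FKConnectivityAllQAntipodalX2WordsTheoremA
import HarnessLib

/-!
# Connectivity correlation inequalities for `φ_{w,q}` — σ-WORDS (gen 12's word model of `X2`), file 11: letters, rows, loser test,
# runs; rows do not see letter multiplicities

Helper file (`--supports stmt-CriticalPhenomena-4575`), FK sub-lane `prim-bschramm-fk-2` (gen 13); builds on p205010 (kernel
theorem, internal audit signed; external expert review pending).  Pure finite combinatorics (memo `bschramm/FROM-fk-2-g13-WORD-HALL.md`
§1.3 and §7.2: the LIFT of Theorem A from type words to gen 12's σ-words).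
A σ-word is a list of letters `(kind, b, b̄)`: the op kind of a spine position and the two-terminal types of its part in `B` and in
`T ∖ B` (memo g12 §4.2).  Row `A` takes a `W` at a series position with `b = false` and a `P` at a parallel position with `b = true`;
row `B` likewise with `b̄` (`sRowA`, `sRowB`); `sIsLoser`, `sIsWinner`, `sRuns` (= `#P - corr`) as in the type model; inert letters
(series `11`, parallel `00`) are invisible (`sRowA_filter_inert`); free letters `01`/`10` and their flip `sflip`.
`expand`/`skel`: `headP`, `lastP`, `runsP` of a row written block by block do not depend on the multiplicities
(`headP_expand`, `lastP_expand`, `runsAux_expand`).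
[cite: Grimmett2006, §3.9 (p. 63)]
-/

namespace Summit.CriticalPhenomena.PercolationContinuityZ3.Theorems

namespace FK

namespace X2Word

/-! ### σ-words (gen 12's word model): letters `(kind, b, b̄)`, rows, loser test, runs -/

section Sigma

/-- A letter of a σ-word: the op kind of the spine position and the part's type `(b, b̄)` = (terminals joined in `B`, in `T \ B`). [folklore] -/
abbrev SLetter := Kind × Bool × Bool

/-- Row `A` sees a series position iff its part is disconnected in `B` (a wall) and a parallel position iff its part is connected
in `B` (a particle). [folklore] -/
def sVisA : SLetter → Bool
  | (.W, b, _) => !b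
  | (.P, b, _) => b

/-- Row `B` likewise with `b̄`. [folklore] -/
def sVisB : SLetter → Bool
  | (.W, _, bb) => !bb
  | (.P, _, bb) => bb

/-- Row `A` of a σ-word. [folklore] -/
def sRowA (w : List SLetter) : List Kind := (w.filter sVisA).map (·.1)

/-- Row `B` of a σ-word. [folklore] -/
def sRowB (w : List SLetter) : List Kind := (w.filter sVisB).map (·.1)

/-- Loser test of a σ-word (the sign `-1` of `X2`, memo g12 §4.2). [folklore] -/
def sIsLoser (w : List SLetter) : Bool :=
  !headP (sRowA w) && lastP (sRowB w) && !(lastP (sRowA w) && !headP (sRowB w))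

/-- Winner test of a σ-word (the sign `+1` of `X2`). [folklore] -/
def sIsWinner (w : List SLetter) : Bool :=
  lastP (sRowA w) && !headP (sRowB w) && !(lastP (sRowB w) && !headP (sRowA w))

/-- Number of particle runs of the two rows (`corr = #particles - sRuns`, memo g12 §4.2). [folklore] -/
def sRuns (w : List SLetter) : ℕ := runsP (sRowA w) + runsP (sRowB w)

/-- An INERT letter: visible to neither row (series `11`, parallel `00`). [folklore] -/
def isInert (l : SLetter) : Bool := !sVisA l && !sVisB l

/-- A FREE letter: `01` (λ) or `10` (ω). [folklore] -/
def isFree (l : SLetter) : Bool := l.2.1 != l.2.2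

/-- The flip `01 ↔ 10` of a free letter (frozen and inert letters are fixed). [folklore] -/
def sflip (l : SLetter) : SLetter := if isFree l then (l.1, l.2.2, l.2.1) else l

/-- The type of a non-inert letter as a one-letter block: `λ ↦ E`, `ω ↦ F`, frozen `↦ M`. [folklore] -/
def lettTy (l : SLetter) : Ty :=
  if l.2 = (false, true) then .E else if l.2 = (true, false) then .F else .M

/-- Row `A` of the empty σ-word. [folklore] -/
@[simp] theorem sRowA_nil : sRowA [] = [] := rfl
/-- Row `B` of the empty σ-word. [folklore] -/
@[simp] theorem sRowB_nil : sRowB [] = [] := rfl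
/-- Row `A`, one letter at a time. [folklore] -/
theorem sRowA_cons (l : SLetter) (w : List SLetter) : sRowA (l :: w) = (if sVisA l then [l.1] else []) ++ sRowA w := by
  unfold sRowA; rw [List.filter_cons]; split_ifs <;> simp
/-- Row `B`, one letter at a time. [folklore] -/
theorem sRowB_cons (l : SLetter) (w : List SLetter) : sRowB (l :: w) = (if sVisB l then [l.1] else []) ++ sRowB w := by
  unfold sRowB; rw [List.filter_cons]; split_ifs <;> simp
/-- Row `A` of a concatenation. [folklore] -/
theorem sRowA_append (u v : List SLetter) : sRowA (u ++ v) = sRowA u ++ sRowA v := by simp [sRowA, List.filter_append]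
/-- Row `B` of a concatenation. [folklore] -/
theorem sRowB_append (u v : List SLetter) : sRowB (u ++ v) = sRowB u ++ sRowB v := by simp [sRowB, List.filter_append]

/-- Inert letters are invisible: rows of a word are rows of its non-inert subsequence. [folklore] -/
theorem sRowA_filter_inert (w : List SLetter) : sRowA (w.filter fun l => !isInert l) = sRowA w := by
  induction w with
  | nil => rfl
  | cons l w ih =>
    rw [List.filter_cons]
    by_cases hl : (!isInert l) = true
    · rw [if_pos hl, sRowA_cons, sRowA_cons, ih]
    · rw [if_neg hl, sRowA_cons, ih]
      have : sVisA l = false := by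
        revert hl; unfold isInert; cases sVisA l <;> simp
      simp [this]

/-- Row `B` analogue. [folklore] -/
theorem sRowB_filter_inert (w : List SLetter) : sRowB (w.filter fun l => !isInert l) = sRowB w := by
  induction w with
  | nil => rfl
  | cons l w ih =>
    rw [List.filter_cons]
    by_cases hl : (!isInert l) = true
    · rw [if_pos hl, sRowB_cons, sRowB_cons, ih]
    · rw [if_neg hl, sRowB_cons, ih]
      have : sVisB l = false := by
        revert hl; unfold isInert; cases sVisA l <;> cases sVisB l <;> simp
      simp [this]

end Sigma

/-! ### Rows up to letter multiplicity: `expand` versus `skel` -/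

section Expand

/-- A row written block by block with multiplicities. [folklore] -/
def expand (L : List (Kind × ℕ)) : List Kind := L.flatMap fun kc => List.replicate kc.2 kc.1

/-- The same row with every nonempty block contributing a single letter. [folklore] -/
def skel (L : List (Kind × ℕ)) : List Kind := L.flatMap fun kc => if 0 < kc.2 then [kc.1] else []

/-- `expand` of a `cons`. [folklore] -/
theorem expand_cons (k : Kind) (c : ℕ) (L : List (Kind × ℕ)) : expand ((k, c) :: L) = List.replicate c k ++ expand L := rfl
/-- `skel` of a `cons`. [folklore] -/
theorem skel_cons (k : Kind) (c : ℕ) (L : List (Kind × ℕ)) : skel ((k, c) :: L) = (if 0 < c then [k] else []) ++ skel L := rfl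

/-- `expand` is empty iff `skel` is. [folklore] -/
theorem expand_eq_nil_iff (L : List (Kind × ℕ)) : expand L = [] ↔ skel L = [] := by
  induction L with
  | nil => simp [expand, skel]
  | cons kc L ih =>
    obtain ⟨k, c⟩ := kc
    rw [expand_cons, skel_cons, List.append_eq_nil_iff, List.append_eq_nil_iff, ih]
    cases c <;> simp

/-- `headP` does not see multiplicities. [folklore] -/
theorem headP_expand (L : List (Kind × ℕ)) : headP (expand L) = headP (skel L) := by
  induction L with
  | nil => rfl
  | cons kc L ih =>
    obtain ⟨k, c⟩ := kc
    rw [expand_cons, skel_cons, headP_append, headP_append, ih]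
    cases c with
    | zero => simp
    | succ c => cases k <;> simp [headP, List.replicate_succ]

/-- `lastP` does not see multiplicities. [folklore] -/
theorem lastP_expand (L : List (Kind × ℕ)) : lastP (expand L) = lastP (skel L) := by
  induction L with
  | nil => rfl
  | cons kc L ih =>
    obtain ⟨k, c⟩ := kc
    rw [expand_cons, skel_cons, lastP_append, lastP_append, ih]
    have e := expand_eq_nil_iff L
    by_cases h0 : skel L = []
    · rw [if_pos (e.mpr h0), if_pos h0]
      cases c with
      | zero => simp
      | succ c =>
        simp only [Nat.succ_pos', if_true, lastP_singleton]
        cases k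
        · exact lastP_of_allW (fun a ha => (List.eq_of_mem_replicate ha))
        · exact lastP_of_allP (fun a ha => (List.eq_of_mem_replicate ha)) (by simp)
    · rw [if_neg (fun h => h0 (e.mp h)), if_neg h0]

/-- `runsP` does not see multiplicities. [folklore] -/
theorem runsAux_expand (b : Bool) (L : List (Kind × ℕ)) : runsAux b (expand L) = runsAux b (skel L) := by
  induction L generalizing b with
  | nil => rfl
  | cons kc L ih =>
    obtain ⟨k, c⟩ := kc
    rw [expand_cons, skel_cons, runsAux_append, runsAux_append, ih]
    cases c with
    | zero => simp [lastFlag]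
    | succ c =>
      simp only [Nat.succ_pos', if_true]
      congr 1
      · cases k
        · rw [runsAux_of_allW _ (fun a ha => List.eq_of_mem_replicate ha)]; simp [runsAux]
        · rw [runsAux_of_allP _ (fun a ha => List.eq_of_mem_replicate ha)]; simp [runsAux]
      · congr 1
        cases k
        · rw [lastFlag_of_allW _ (fun a ha => List.eq_of_mem_replicate ha), lastFlag_cons]; simp [lastFlag]
        · rw [lastFlag_of_allP _ (fun a ha => List.eq_of_mem_replicate ha), lastFlag_cons]; simp [lastFlag]

end Expand


end X2Word

end FK

end Summit.CriticalPhenomena.PercolationContinuityZ3.Theorems
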